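import Summits.Ventures.LatticeQCDFlow.Scaling.CouplingOverlap

/-!
HONEST FRAMING: exact (Metropolis-corrected) sampling algorithms for lattice gauge theory; figures
of merit are autocorrelation/cost numbers at stated couplings and volumes; no continuum-physics
claim.

# SimulatedTemperingAcceptance — THE LEVEL-MOVE ACCEPTANCE OF SIMULATED TEMPERING (EXPANDED ENSEMBLE,
# EXACT WEIGHTS) BETWEEN PARAMETERS `s → t` EQUALS THE OVERLAP `∫ min(p_s, p_t) = 1 − TV(μ_s, μ_t)`, HENCE
# `exp(−((t−s)√M + M(t−s)²)) ≤ acc_ST ≤ exp(−m(t−s)²/8)` AND `m(β_K − β_0)² ≤ 8K² log(1/α)` LEVELS —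
# EVERY COMPACT GAUGE GROUP, EVERY COUPLING (lean-2 GEN-11, ours)

Venture-side (OURS).  Cell `lqcd-flow` (pub-lqcd), unit `pub-lqcd-lean-2-g11`, 2026-08-23.  Third protocol
governed by the same quantities (after the replica-exchange swap and the independence sampler): SIMULATED
TEMPERING / the expanded ensemble (Marinari–Parisi 1992; Lyubartsev et al. 1992) walks ONE replica through the
ladder; with the exact (free-energy) weights `1/Z(β_k)` the Metropolis acceptance of the level move `s → t`
at configuration `x` is `min(1, p_t(x)/p_s(x))`, `p_u = e^{uX}/mgf(u)` the normalised densities.  Setting of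
`SwapAcceptanceLaw`: `μ` probability, `X` bounded measurable, `μ_u = μ.tilted(u·X)`, `ψ = cgf X μ`.

* §1 **`stAcc_eq_overlap`**: `∫ min(1, p_t/p_s) dμ_s = ∫ min(p_s, p_t) dμ` — the stationary mean level-move
  acceptance IS the overlap (`= 1 − TV(μ_s, μ_t)`, `CouplingOverlap.overlap_eq_one_sub_half_integral_abs`);
  hence (`s ≤ t`) **`stAcc ≤ exp(−m(t−s)²/8)`** under a variance floor and
  **`stAcc ≥ exp(−((t−s)√M + M(t−s)²))`** under a ceiling (`stAcc_le_exp_neg_floor`, `stAcc_ge_exp_neg_ceiling`);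
  **LEVEL-LADDER NECESSITY** `st_ladder_necessary`: monotone levels `β_0 ≤ … ≤ β_K`, floor `m ≥ 0`, every upward
  level move accepted with probability `≥ α > 0` ⇒ `m(β_K − β_0)² ≤ 8K²·log(1/α)`.
* §2 Wilson, every compact `G`: `wilson_stAcc_le_of_floor`, **`wilson_st_ladder_necessary_allCouplings`**
  (unitary `ρ`, `d ≥ 2`, `L ≥ 2`, levels in `[−B,B]`): `e^{−B·2NK(1+4K)}·⌊L/2⌋^d·Var_Haar(Re tr ρ)·(β_K−β_0)² ≤
  8K²·log(1/α)` — simulated tempering in the coupling also needs `Ω((b−a)√volume)` levels;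
  **`wilson_st_ladder_necessary_sun`** (`SU(n)`): `c·#plaq/(1+β_K²)·(β_K−β_0)² ≤ 8K²·log(1/α)`.

Literature grade (cell rule): KNOWN MECHANISM (simulated tempering: Marinari–Parisi, Europhys. Lett. 19 (1992)
451; level spacing `∝ 1/√C_V` as for parallel tempering), NEW TYPING; nothing cited as a fact.  NOT CLAIMED:
anything about estimated (non-exact) weights, round-trip times, or finite samples.
-/

noncomputable section

open MeasureTheory ProbabilityTheory Real Set
open Literature.MathematicalPhysics.QuantumFieldTheory
open Literature.MathematicalPhysics.QuantumFieldTheory.Luscher2010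
open Summit.Ventures.LatticeQCDFlow.TrivializingMaps
open scoped Matrix Matrix.Norms.Frobenius ContDiff

namespace Summit.Ventures.LatticeQCDFlow.Scaling

/-! ## §1 Abstract: the level-move acceptance is the overlap -/

section Abstract

variable {Ω : Type*} [MeasurableSpace Ω] {μ : Measure Ω} [IsProbabilityMeasure μ] {X : Ω → ℝ}

/-- **THE SIMULATED-TEMPERING LEVEL-MOVE ACCEPTANCE IS THE OVERLAP**:
`∫ min(1, p_t(x)/p_s(x)) dμ_s(x) = ∫ min(p_s, p_t) dμ`. [ours] -/
theorem stAcc_eq_overlap (hXm : Measurable X) (hXb : ∃ C, ∀ x, |X x| ≤ C) (s t : ℝ) :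
    ∫ x, min 1 ((exp (t * X x) / mgf X μ t) / (exp (s * X x) / mgf X μ s)) ∂(μ.tilted fun x => s * X x) =
      ∫ x, min (exp (s * X x) / mgf X μ s) (exp (t * X x) / mgf X μ t) ∂μ := by
  have hZs : 0 < mgf X μ s := mgf_pos_of_bounded hXm hXb s
  rw [integral_tilted_mul_eq_mgf]
  refine integral_congr_ae (ae_of_all _ fun x => ?_)
  have hps : 0 < exp (s * X x) / mgf X μ s := div_pos (exp_pos _) hZs
  simp only [smul_eq_mul]
  rw [mul_min_of_nonneg _ _ hps.le, mul_one, mul_div_cancel₀ _ hps.ne']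

/-- **Level-move acceptance under a variance floor** (`s ≤ t`, `m ≤ Var_{μ_u}(X)` on `[s,t]`):
`stAcc ≤ exp(−m(t−s)²/8)`. [ours] -/
theorem stAcc_le_exp_neg_floor (hXm : Measurable X) (hXb : ∃ C, ∀ x, |X x| ≤ C) {s t m : ℝ}
    (hst : s ≤ t) (hm : ∀ u ∈ Icc s t, m ≤ variance X (μ.tilted fun x => u * X x)) :
    ∫ x, min 1 ((exp (t * X x) / mgf X μ t) / (exp (s * X x) / mgf X μ s)) ∂(μ.tilted fun x => s * X x) ≤
      exp (-(m * (t - s) ^ 2 / 8)) := by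
  rw [stAcc_eq_overlap hXm hXb s t]
  exact overlap_le_exp_neg_floor hXm hXb hst hm

/-- **Level-move acceptance under a variance ceiling** (`s ≤ t`, `Var_{μ_u}(X) ≤ M` on `[s,t]`):
`stAcc ≥ exp(−((t−s)√M + M(t−s)²))`. [ours] -/
theorem stAcc_ge_exp_neg_ceiling (hXm : Measurable X) (hXb : ∃ C, ∀ x, |X x| ≤ C) {s t M : ℝ}
    (hst : s ≤ t) (hM : ∀ u ∈ Icc s t, variance X (μ.tilted fun x => u * X x) ≤ M) :
    exp (-((t - s) * sqrt M + M * (t - s) ^ 2)) ≤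
      ∫ x, min 1 ((exp (t * X x) / mgf X μ t) / (exp (s * X x) / mgf X μ s)) ∂(μ.tilted fun x => s * X x) := by
  rw [stAcc_eq_overlap hXm hXb s t]
  exact overlap_ge_exp_neg_ceiling hXm hXb hst hM

/-- **LEVEL-LADDER NECESSITY**: monotone levels `β`, a variance floor `m ≥ 0` on `[β_0, β_K]`, and every
upward level move `β_j → β_{j+1}` accepted (at stationarity in level `j`) with probability `≥ α > 0` imply
`m·(β_K − β_0)² ≤ 8K²·log(1/α)`. [ours] -/
theorem st_ladder_necessary (hXm : Measurable X) (hXb : ∃ C, ∀ x, |X x| ≤ C) {m : ℝ} (hm0 : 0 ≤ m)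
    (K : ℕ) (β : ℕ → ℝ) (hβ : Monotone β)
    (hfloor : ∀ u ∈ Icc (β 0) (β K), m ≤ variance X (μ.tilted fun x => u * X x))
    {α : ℝ} (hα : 0 < α)
    (hacc : ∀ j < K, α ≤ ∫ x, min 1 ((exp (β (j + 1) * X x) / mgf X μ (β (j + 1))) /
      (exp (β j * X x) / mgf X μ (β j))) ∂(μ.tilted fun x => β j * X x)) :
    m * (β K - β 0) ^ 2 ≤ 8 * (K : ℝ) ^ 2 * log (1 / α) := by
  have hstep : ∀ j < K, m * (β (j + 1) - β j) ^ 2 ≤ 8 * log (1 / α) := by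
    intro j hj
    have hsub : Icc (β j) (β (j + 1)) ⊆ Icc (β 0) (β K) :=
      Icc_subset_Icc (hβ (Nat.zero_le j)) (hβ (Nat.succ_le_of_lt hj))
    have hA := (hacc j hj).trans (stAcc_le_exp_neg_floor hXm hXb (hβ (Nat.le_succ j))
      fun u hu => hfloor u (hsub hu))
    have hlog := (log_le_iff_le_exp hα).2 hA
    rw [one_div, log_inv]
    linarith
  have hsum : ∑ j ∈ Finset.range K, (β (j + 1) - β j) = β K - β 0 := Finset.sum_range_sub β K
  have hcs : (∑ j ∈ Finset.range K, (β (j + 1) - β j)) ^ 2 ≤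
      K * ∑ j ∈ Finset.range K, (β (j + 1) - β j) ^ 2 := by
    have h := sq_sum_le_card_mul_sum_sq (s := Finset.range K) (f := fun j => β (j + 1) - β j)
    simpa [Finset.card_range] using h
  have hsumsq : m * ∑ j ∈ Finset.range K, (β (j + 1) - β j) ^ 2 ≤ K * (8 * log (1 / α)) := by
    rw [Finset.mul_sum]
    calc ∑ j ∈ Finset.range K, m * (β (j + 1) - β j) ^ 2
        ≤ ∑ _j ∈ Finset.range K, 8 * log (1 / α) :=
          Finset.sum_le_sum fun j hj => hstep j (Finset.mem_range.1 hj)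
      _ = K * (8 * log (1 / α)) := by rw [Finset.sum_const, Finset.card_range, nsmul_eq_mul]
  rw [← hsum]
  calc m * (∑ j ∈ Finset.range K, (β (j + 1) - β j)) ^ 2
      ≤ m * (K * ∑ j ∈ Finset.range K, (β (j + 1) - β j) ^ 2) := mul_le_mul_of_nonneg_left hcs hm0
    _ = K * (m * ∑ j ∈ Finset.range K, (β (j + 1) - β j) ^ 2) := by ring
    _ ≤ K * (K * (8 * log (1 / α))) := mul_le_mul_of_nonneg_left hsumsq (Nat.cast_nonneg K)
    _ = 8 * (K : ℝ) ^ 2 * log (1 / α) := by ring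

end Abstract

/-! ## §2 The Wilson coupling family, every compact gauge group -/

section Wilson

variable {d L N : ℕ} [NeZero L] {G : Type*} [Group G] [TopologicalSpace G] [IsTopologicalGroup G]
  [CompactSpace G] [MeasurableSpace G] [BorelSpace G] [SecondCountableTopology G]
  (ρ : G →* Matrix (Fin N) (Fin N) ℂ)

/-- **Level-move acceptance between Wilson couplings under a specific-heat floor** (`a ≤ b`,
`m ≤ Var_u(S_W)` on `[a,b]`): `∫ min(1, p_b/p_a) dμ_a ≤ exp(−m(b−a)²/8)`. [ours] -/
theorem wilson_stAcc_le_of_floor (hρ : Continuous ρ) {a b m : ℝ} (hab : a ≤ b)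
    (hm : ∀ u ∈ Icc a b, m ≤ variance (wilsonAction (d := d) (L := L) ρ) (wilsonMeasure (d := d) (L := L) ρ u)) :
    ∫ U, min 1 ((exp (b * (-wilsonAction ρ U)) / mgf (fun U => -wilsonAction ρ U) (trivialMeasure G d L) b) /
        (exp (a * (-wilsonAction ρ U)) / mgf (fun U => -wilsonAction ρ U) (trivialMeasure G d L) a))
        ∂(wilsonMeasure (d := d) (L := L) ρ a) ≤ exp (-(m * (b - a) ^ 2 / 8)) := by
  haveI : IsProbabilityMeasure (trivialMeasure G d L) := trivialMeasure_isProbabilityMeasure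
  rw [← tilted_neg_wilsonAction_eq ρ hρ a]
  refine stAcc_le_exp_neg_floor (μ := trivialMeasure G d L) (measurable_neg_wilsonAction ρ hρ)
    (neg_wilsonAction_bounded ρ hρ) hab fun u hu => ?_
  have h := hm u hu
  rwa [← tilted_neg_wilsonAction_eq ρ hρ u, ← variance_fun_neg] at h

/-- **LEVEL-LADDER NECESSITY FOR THE WILSON FAMILY UNDER ANY FLOOR.** [ours] -/
theorem wilson_st_ladder_necessary (hρ : Continuous ρ) {m : ℝ} (hm0 : 0 ≤ m) (K : ℕ) (β : ℕ → ℝ)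
    (hβ : Monotone β)
    (hfloor : ∀ u ∈ Icc (β 0) (β K),
      m ≤ variance (wilsonAction (d := d) (L := L) ρ) (wilsonMeasure (d := d) (L := L) ρ u))
    {α : ℝ} (hα : 0 < α)
    (hacc : ∀ j < K, α ≤ ∫ U, min 1 ((exp (β (j + 1) * (-wilsonAction ρ U)) /
        mgf (fun U => -wilsonAction ρ U) (trivialMeasure G d L) (β (j + 1))) /
      (exp (β j * (-wilsonAction ρ U)) / mgf (fun U => -wilsonAction ρ U) (trivialMeasure G d L) (β j)))
      ∂(wilsonMeasure (d := d) (L := L) ρ (β j))) :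
    m * (β K - β 0) ^ 2 ≤ 8 * (K : ℝ) ^ 2 * log (1 / α) := by
  haveI : IsProbabilityMeasure (trivialMeasure G d L) := trivialMeasure_isProbabilityMeasure
  refine st_ladder_necessary (μ := trivialMeasure G d L) (measurable_neg_wilsonAction ρ hρ)
    (neg_wilsonAction_bounded ρ hρ) hm0 K β hβ (fun u hu => ?_) hα (fun j hj => ?_)
  · have h := hfloor u hu
    rwa [← tilted_neg_wilsonAction_eq ρ hρ u, ← variance_fun_neg] at h
  · rw [tilted_neg_wilsonAction_eq ρ hρ (β j)]
    exact hacc j hj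

/-- **SIMULATED TEMPERING IN THE COUPLING NEEDS `Ω((b−a)√volume)` LEVELS AT EVERY COUPLING, EVERY COMPACT
GAUGE GROUP** (unitary `ρ`, `d ≥ 2`, `L ≥ 2`, levels in `[−B, B]`):
`e^{−B·2NK(1+4K)}·⌊L/2⌋^d·Var_Haar(Re tr ρ)·(β_K − β_0)² ≤ 8K²·log(1/α)`. [ours] -/
theorem wilson_st_ladder_necessary_allCouplings (hd : 2 ≤ d) (hL : 2 ≤ L) (hρ : Continuous ρ)
    (hρu : ∀ g, ρ g ∈ Matrix.unitaryGroup (Fin N) ℂ) (K : ℕ) (β : ℕ → ℝ) (hβ : Monotone β) {B : ℝ}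
    (hlo : -B ≤ β 0) (hhi : β K ≤ B) {α : ℝ} (hα : 0 < α)
    (hacc : ∀ j < K, α ≤ ∫ U, min 1 ((exp (β (j + 1) * (-wilsonAction ρ U)) /
        mgf (fun U => -wilsonAction ρ U) (trivialMeasure G d L) (β (j + 1))) /
      (exp (β j * (-wilsonAction ρ U)) / mgf (fun U => -wilsonAction ρ U) (trivialMeasure G d L) (β j)))
      ∂(wilsonMeasure (d := d) (L := L) ρ (β j))) :
    Real.exp (-(B * (2 * N * ((d + 1) * d ^ 2 : ℕ) * (1 + 4 * ((d + 1) * d ^ 2 : ℕ))))) *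
        ((L / 2) ^ d : ℕ) * variance (fun g => (ρ g).trace.re) (haarProbability G) * (β K - β 0) ^ 2 ≤
      8 * (K : ℝ) ^ 2 * log (1 / α) := by
  have hv : 0 ≤ variance (fun g => (ρ g).trace.re) (haarProbability G) := variance_nonneg _ _
  refine wilson_st_ladder_necessary (d := d) (L := L) ρ hρ (by positivity) K β hβ (fun u hu => ?_) hα hacc
  refine le_trans ?_ (wilson_variance_ge_allCouplings (d := d) (L := L) ρ hd hL hρ hρu u)
  have hu : |u| ≤ B := abs_le.2 ⟨by linarith [hu.1], by linarith [hu.2]⟩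
  have hc : 0 ≤ (2 * N * ((d + 1) * d ^ 2 : ℕ) * (1 + 4 * ((d + 1) * d ^ 2 : ℕ)) : ℝ) := by positivity
  gcongr

end Wilson

/-! ## §3 `SU(n)` -/

section SUN

variable {d n : ℕ}

/-- **`SU(n)` LEVEL-LADDER NECESSITY** (`n ≥ 2`, `d ≥ 2`): one `c = c(n,d) > 0` with
`c·#plaq/(1+β_K²)·(β_K − β_0)² ≤ 8K²·log(1/α)` for every `L ≥ 2`, every monotone level sequence
`0 ≤ β_0 ≤ … ≤ β_K` whose upward level moves are all accepted with probability `≥ α > 0`. [ours] -/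
theorem wilson_st_ladder_necessary_sun (hn : 2 ≤ n) (hd : 2 ≤ d) :
    ∃ c : ℝ, 0 < c ∧ ∀ (L : ℕ) [NeZero L], 2 ≤ L → ∀ (K : ℕ) (β : ℕ → ℝ), Monotone β → 0 ≤ β 0 →
      ∀ α : ℝ, 0 < α →
      (∀ j < K, α ≤ ∫ U, min 1 ((exp (β (j + 1) * (-wilsonAction (StrongCoupling.defRep n) U)) /
          mgf (fun U => -wilsonAction (StrongCoupling.defRep n) U)
            (trivialMeasure (Matrix.specialUnitaryGroup (Fin n) ℂ) d L) (β (j + 1))) /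
        (exp (β j * (-wilsonAction (StrongCoupling.defRep n) U)) /
          mgf (fun U => -wilsonAction (StrongCoupling.defRep n) U)
            (trivialMeasure (Matrix.specialUnitaryGroup (Fin n) ℂ) d L) (β j)))
        ∂(wilsonMeasure (d := d) (L := L) (StrongCoupling.defRep n) (β j))) →
      c * Fintype.card (Plaquette d L) / (1 + β K ^ 2) * (β K - β 0) ^ 2 ≤
        8 * (K : ℝ) ^ 2 * log (1 / α) := by
  obtain ⟨c, hc, h⟩ := wilson_variance_floor_allCouplings_rep (d := d) (n := n) hn hd
  refine ⟨c, hc, fun L _ hL K β hβ h0 α hα hacc => ?_⟩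
  have hρ : Continuous (StrongCoupling.defRep n) := continuous_subtype_val
  have hm0 : 0 ≤ c * Fintype.card (Plaquette d L) / (1 + β K ^ 2) := by positivity
  refine wilson_st_ladder_necessary (d := d) (L := L) (StrongCoupling.defRep n) hρ hm0 K β hβ
    (fun u hu => ?_) hα hacc
  have hu0 : 0 ≤ u := h0.trans hu.1
  refine le_trans ?_ (h L hL u hu0)
  have hP : 0 ≤ c * Fintype.card (Plaquette d L) := by positivity
  have h1 : 1 + u ^ 2 ≤ 1 + β K ^ 2 := by nlinarith [hu.2, hu0]
  exact div_le_div_of_nonneg_left hP (by positivity) h1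

end SUN

end Summit.Ventures.LatticeQCDFlow.Scaling

end
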